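import Literature.MathematicalPhysics.QuantumFieldTheory.Balaban1983to89.B8Prop6CubeMemberNorms

/-!
# `Balaban1983to89.B8Prop6CubeMemberNormsAt` — [Balaban1985RegularSpaces] PROPOSITION 6 (p. 99), (1.136)₂–₄ AT THE CONCRETE CUBE MEMBER
# with the [4]-Thm-3.3 socket AT THE MEMBER ONLY, every window from print's «7dL²Mα₀ ≤ c₁», and print's constant `7dL²B₁Mα₀`

statement-level skeleton of published theorems with citation tags; proofs where landed; nothing here is a claim about the
Yang–Mills mass gap

T. Bałaban, *Spaces of regular gauge field configurations on a lattice and gauge fixing conditions*, Commun. Math. Phys. **99**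
(1985) 75–102 `[Balaban1985RegularSpaces]` ("B8"), Sect. F p. 99 (Proposition 6), Proposition 3 p. 87, (1.40)–(1.42) p. 83, (1.59)–(1.61) p. 86,
p. 88 (the sentence after Theorem 4).

CITATION HEADER (lean-in-tree rule).  Cell `pub-ymgap` (YM Track A, HUMAN RULING D-0062), DAG node N05 = [B8], seat `pub-ymgap-dag-n05-e`
(R141 (C) fan-out; FAN-OUT v1.1 §N05 row s3b, module 3b-ii).  WHY: `B8Prop6CubeMemberNorms.norms136_cubeMember` (module 3b-i) obtains
(1.136)₂–₄ at the cube member from `B8LeafModelZd3.prop3Printed_zd3`, whose socket binder is FAMILY-WIDE, `∀ i : ZdIdx d L, SockB9P3 …`;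
dag-lead WORDS-105 ∕ referee ref-A J2′ (2026-08-26) record that this binder is UNSATISFIABLE over the unrestricted index (a degenerate
member with `Λb ≡ ∅` refutes its own socket), so that form is vacuous as a hypothesis.  THIS MODULE re-derives Proposition 3 at the member
with the Prop.-3-frame b9 socket ([4] Thm 3.3 for `G(1)`, `H(1)`) AT THE CUBE MEMBER ONLY — `SockB9P3 L B₀ B₀β cB9 β len η k {□_j} (cubeLamS …)
(cubeLamB …)`, the instance any law-abiding sub-family binder (`Node00.IdxB8Sub`) yields at the member — by calling n05-b's kernel
Proposition 3 `B8Prop3KLevel.prop3_norms_kLevel` ∕ `prop3_fifth_kLevel` directly (the proof of `prop3Printed_zd3` transposed to the member,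
background `1`); then derives every window from print's «`7dL²Mα₀ ≤ c₁`» and «`L ≤ dM`» and states the members with print's constant
`7dL²B₁Mα₀`, `B₁ = 5dLB₀` (`B8Prop6OfThm4.const_136`).  Kind «kernel-checked proof», theorems only, no `def`.

DICTIONARY: as in `B8Prop6CubeMemberNorms` (`A := mlogCfg k η {□_j} U₁`, `U₁ = U₀″^{u⁻¹}`, k-level norms `msup`∕`bondNorm`, Hölder quotients
`hquot`, constraint bonds `cubeLamB … k j`).

WHAT THIS MODULE PROVES (kernel, 0 sorry).  §1 **`norms136_cubeMember_at`** — PROPOSITION 3 AT THE MEMBER, MEMBER-ONLY SOCKET: ONE threshold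
`c(d, L, B₀, cB9) > 0` (`B8LeafModelZd3.prop3_windows` ∧ `cB9`) such that, for the datum of Sect. F, `(α₀′, α₂) := (L³α₀, 5dLB₀(L³α₀ +
6dL²Mα₀)) ≤ c`, (1.61), `dL·6dL²Mα₀ ≤ 1∕8`, and any unitary `u` with (1.29) at level `k`, (1.38) of record and the (1.62)-shape with constant
`α₂`: the four norm members `≤ 5dLB₀·s`, `5dLB₀β·s`, `s = α₀′ + 6dL²Mα₀` — (1.40)₁ for `1`, (1.40)₂ by gauge invariance from (1.132) and
locality (`inAk_congr_of_sideTouches`), (1.41) = the (1.62)-shape through `mlogCfg_spec`, (1.42) = (1.38) + `c137_cubeMember`, the five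
(1.59) lines from the socket, Proposition 3 = `prop3_norms_kLevel` + `prop3_fifth_kLevel` BY NAME.  §2 **`windows136_of_small`** — every
window from ONE `7dL²Mα₀ ≤ c₁(d, L, B₀, C₂, c)` and `L ≤ dM` (`regime_of_printed_smallness`, `ineq161_of_small`, `prop3_windows`,
`B8.prop6_smallness_iff`).  §3 **`norms136_cubeMember_printed`** — §1 + `c137_cubeMember` under print's «`7dL²Mα₀ ≤ c₁`», «`L ≤ dM`»,
with print's constant: all-levels (1.37) `< 2dL·6dL²Mα₀`, `|∇^ηA|₍₋₂₎, |∂^{η*}∂^ηA|₍₋₃₎, |Δ^ηA|₍₋₃₎ ≤ 7dL²(5dLB₀)Mα₀`, Hölder `≤ 7dL²(5dLB₀β)Mα₀`.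

HONEST SCOPE.  (i) `ℤᵈ` carriers, `𝔸` a C⋆-algebra.  (ii) `u` DISPLAYED with its properties (Theorem 4's output at the member, n05-c's
`prop6_exists_cubeMember_of_HFP₄`); not re-derived.  (iii) MODULO the Prop.-3-frame b9 socket at the cube member (displayed, not discharged;
its truth is [4] Thm 3.3 composed with Prop. 6 — N06's supply) and the (1.61)-constant `C₂ ≥ 2097152(d+1)²`.  (iv) Norm form `≤` of the k-level
weighted suprema for print's pointwise `<` «on □_j».  Count-neutral; N05 NOT discharged; nothing continuum ∕ ℝ⁴ ∕ OS ∕ mass-gap ∕ Clay.  Unit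
`pub-ymgap-dag-n05-e` (g0), 2026-08-26.
-/

noncomputable section

open NormedSpace

namespace Literature.MathematicalPhysics.QuantumFieldTheory.Balaban1983to89.B8Prop6CubeMemberNormsAt

open MatrixLog B7Prop1Explicit B7Prop2Explicit B7Prop1Local B7Eq92Concrete
open B7Prop3Flat (c3 c3_pos)
open B7Prop4GeneralLevels (logCovIter linCovIter)
open B8Ineq130 (gaugeAct_one)
open B8Ineq132 (covDerivFwd InAk inAk_gaugeAct_iff)
open B8Ineq133 (cutFixed)
open B8Lemma1NonAbelian (mulCfg)
open B8Eq115GaugeFixing (gaugeAct_mul gaugeAct_mem_of)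
open B8Eq146AExpansion (iEta expCfg plaqCovDeriv)
open B8Eq143PlaqExpansion (pdiv)
open B8Eq184Proof (cfgExp)
open B8Eq140Level (SideTouches)
open B8Eq119TwistedAxial (InAx Restr129)
open B8Eq155JBound (Jcur wsup)
open B8ScaledSupNorm (bondNorm msup weight Bdd)
open B8Eq138LandauZd (IsLandau138W logCfg covLap)
open B8Eq131Cubes (tcube tLo tHi ctr)
open B8Eq131CubesAdmissible (cubeFam)
open B8CubeMemberZd (cubeLamS cubeLamB hbox_cubeLamB)
open B8Prop6CubeMember (thm4_hypotheses_one_cutFixed regime_of_printed_smallness)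
open B8Prop6OfThm4 (const_136)
open B8Prop3GaugeFixedKLevel (inAk_congr_of_sideTouches expCfg_iEta_eq_cfgExp)
open B8LeafModelZd3 (mlogCfg mlogCfg_spec mlogCfg_of_sideTouches mlogCfg_of_not SockB9P3 prop3_windows)
open B9Eq340HolderZd (hquot AdmPair)
open B8Prop6CubeMemberNorms (c137_cubeMember ineq161_of_small)

-- `Site` alone could resolve to the torus sites of `Setup.lean`; re-export the `ℤ^d` sites of `B7Prop1Explicit`.
export B7Prop1Explicit (Site)

variable {d : ℕ}

variable {𝔸 : Type} [CStarAlgebra 𝔸] [Nontrivial 𝔸]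

/-! ## §1 Proposition 3 at the member, the b9 socket at the member only -/

/-- **PROPOSITION 3 (p. 87) AT THE CONCRETE CUBE MEMBER, BACKGROUND `1`, MEMBER-ONLY SOCKET: THE NORM MEMBERS OF (1.136)** («thus there
exists a gauge transformation u such that U₁ = U₀″^{u⁻¹} satisfies the conditions (1.36)–(1.39)», p. 99 — the (1.36)₂ ∕ Hölder ∕ (1.39) part).  For
`d, L ≥ 2`, `B₀ > 0`, `B₀β ≥ 0`, `C₂ ≥ 2097152(d+1)²`, `cB9 > 0`, Hölder data `β, len`: ONE threshold `c > 0` such that for every datum of Sect. F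
(`k ≥ 1`, `L ≤ ρ ≤ M`, `11d < M`, unitary `U₀ ∈ 𝔄_k({Ω_j}, α₀)`, `□̃ ⊂ Ω_{k−1}`, the (1.130)-regime) carrying the Prop.-3-frame b9 socket AT THE
MEMBER (`SockB9P3 … η k {□_j} (cubeLamS …) (cubeLamB …)`), whose parameters `(α₀′, α₂) := (L³α₀, 5dLB₀(L³α₀ + 6dL²Mα₀))` are `≤ c` and satisfy
(1.61) and `dL·6dL²Mα₀ ≤ 1∕8`, and every unitary `u` with (1.29) at level `k`, (1.38) of record and the (1.62)-shape with constant `α₂`, for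
`A := mlogCfg k η {□_j} U₁`, `s := L³α₀ + 6dL²Mα₀`: `|∇^ηA|₍₋₂₎ ≤ 5dLB₀·s`, Hölder `≤ 5dLB₀β·s`, `|∂^{η*}∂^ηA|₍₋₃₎, |Δ^ηA|₍₋₃₎ ≤ 5dLB₀·s`.
[cite: Balaban1985RegularSpaces, Prop. 3 p.87, Prop. 6 (1.136) p.99, (1.40)–(1.42) p.83, (1.59)–(1.61) p.86, p.88] -/
theorem norms136_cubeMember_at (hd2 : 2 ≤ d) {L : ℕ} (hL : 2 ≤ L) {B₀ B₀β C₂ cB9 : ℝ} (hB₀ : 0 < B₀) (hB₀β : 0 ≤ B₀β)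
    (hC₂ : 2097152 * ((d : ℝ) + 1) ^ 2 ≤ C₂) (hcB9 : 0 < cB9) (β : ℝ) (len : Site d → ℝ) :
    ∃ c : ℝ, 0 < c ∧ ∀ (η : ℝ), 0 < η → ∀ (k : ℕ), 1 ≤ k → ∀ (a : Site d) (M ρ : ℕ), L ≤ ρ → ρ ≤ M → 11 * (d : ℝ) < M →
      SockB9P3 (𝔸 := 𝔸) L B₀ B₀β cB9 β len η k (cubeFam false L a M ρ k) (cubeLamS L a M ρ k) (cubeLamB L a M ρ k) →
      ∀ (U₀ : Site d → Fin d → 𝔸ˣ), (∀ x κ, U₀ x κ ∈ unitaryUnits 𝔸) → ∀ (α₀ : ℝ), 0 < α₀ →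
      C0 d * (α₀ * (L : ℝ) ^ 2) ≤ 1 / 3 → 2 * (α₀ * (L : ℝ) ^ 2) ≤ c2' d L →
      ∀ (Ω : ℕ → Set (Site d)), InAk L k η α₀ Ω U₀ → tcube L a M ρ k ⊆ Ω (k - 1) →
      11 * (d : ℝ) ^ 2 * (L : ℝ) ^ 2 * α₀ + ((M : ℝ) + 4 * ρ) * d * (L : ℝ) ^ 2 * α₀ ≤ 1 / 6 →
      (L : ℝ) ^ 3 * α₀ ≤ c → 5 * (d : ℝ) * L * B₀ * ((L : ℝ) ^ 3 * α₀ + 6 * d * (L : ℝ) ^ 2 * M * α₀) ≤ c →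
      2 * (5 * (d : ℝ) * L * B₀ * ((L : ℝ) ^ 3 * α₀ + 6 * d * (L : ℝ) ^ 2 * M * α₀)) ^ 2
        + 20 * d * ((L : ℝ) ^ 3 * α₀) * (5 * (d : ℝ) * L * B₀ * ((L : ℝ) ^ 3 * α₀ + 6 * d * (L : ℝ) ^ 2 * M * α₀))
        + 2 * C₂ * (5 * (d : ℝ) * L * B₀ * ((L : ℝ) ^ 3 * α₀ + 6 * d * (L : ℝ) ^ 2 * M * α₀)) ^ 2
        ≤ (L : ℝ) ^ 3 * α₀ + 6 * d * (L : ℝ) ^ 2 * M * α₀ →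
      (d : ℝ) * L * (6 * d * (L : ℝ) ^ 2 * M * α₀) ≤ 1 / 8 →
      ∀ (u : Site d → 𝔸ˣ), (∀ x, u x ∈ unitaryUnits 𝔸) →
      Restr129 L k (cubeLamS L a M ρ k k) (1 : Site d → Fin d → 𝔸ˣ) u →
      IsLandau138W L k η (cubeFam false L a M ρ k 0) (cubeLamS L a M ρ k k) (1 : Site d → Fin d → 𝔸ˣ)
        (gaugeAct u⁻¹ (cutFixed L (tLo a ρ) (tHi a M ρ) U₀ k (ctr a M))) →
      (∀ j, j ≤ k → ∀ b ∈ {b : Site d × Fin d | SideTouches (cubeFam false L a M ρ k j) b.1 b.2},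
        gaugeAct u⁻¹ (cutFixed L (tLo a ρ) (tHi a M ρ) U₀ k (ctr a M)) b.1 b.2 =
            cfgExp η (logCfg η (gaugeAct u⁻¹ (cutFixed L (tLo a ρ) (tHi a M ρ) U₀ k (ctr a M)))) b.1 b.2 ∧
          IsSelfAdjoint (logCfg η (gaugeAct u⁻¹ (cutFixed L (tLo a ρ) (tHi a M ρ) U₀ k (ctr a M))) b.1 b.2) ∧
          ‖logCfg η (gaugeAct u⁻¹ (cutFixed L (tLo a ρ) (tHi a M ρ) U₀ k (ctr a M))) b.1 b.2‖ ≤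
            (5 * (d : ℝ) * L * B₀ * ((L : ℝ) ^ 3 * α₀ + 6 * d * (L : ℝ) ^ 2 * M * α₀)) * ((L : ℝ) ^ j * η)⁻¹) →
      msup L k η (-(2 : ℝ)) (fun j (t : Fin d × Fin d × Site d) => SideTouches (cubeFam false L a M ρ k j) t.2.2 t.2.1)
          (fun t => covDerivFwd η (1 : Site d → Fin d → 𝔸ˣ) t.1 (fun z => mlogCfg k η (cubeFam false L a M ρ k)
            (gaugeAct u⁻¹ (cutFixed L (tLo a ρ) (tHi a M ρ) U₀ k (ctr a M))) z t.2.1) t.2.2)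
        ≤ 5 * (d : ℝ) * L * B₀ * ((L : ℝ) ^ 3 * α₀ + 6 * d * (L : ℝ) ^ 2 * M * α₀) ∧
      msup L k η (-(2 + β)) (fun j (q : Fin d × Fin d × (Site d × Site d)) => q.2.2 ∈ AdmPair η len ∧ q.2.2.1 ∈ cubeFam false L a M ρ k j)
          (fun q => hquot η β len (1 : Site d → Fin d → 𝔸ˣ) (covDerivFwd η (1 : Site d → Fin d → 𝔸ˣ) q.1
            (fun z => mlogCfg k η (cubeFam false L a M ρ k) (gaugeAct u⁻¹ (cutFixed L (tLo a ρ) (tHi a M ρ) U₀ k (ctr a M))) z q.2.1))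
            q.2.2)
        ≤ 5 * (d : ℝ) * L * B₀β * ((L : ℝ) ^ 3 * α₀ + 6 * d * (L : ℝ) ^ 2 * M * α₀) ∧
      bondNorm L k η (-(3 : ℝ)) (cubeFam false L a M ρ k) (fun x μ => pdiv η (1 : Site d → Fin d → 𝔸ˣ)
          (plaqCovDeriv η (1 : Site d → Fin d → 𝔸ˣ) (mlogCfg k η (cubeFam false L a M ρ k)
            (gaugeAct u⁻¹ (cutFixed L (tLo a ρ) (tHi a M ρ) U₀ k (ctr a M))))) μ x)
        ≤ 5 * (d : ℝ) * L * B₀ * ((L : ℝ) ^ 3 * α₀ + 6 * d * (L : ℝ) ^ 2 * M * α₀) ∧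
      bondNorm L k η (-(3 : ℝ)) (cubeFam false L a M ρ k) (fun x μ => covLap η (1 : Site d → Fin d → 𝔸ˣ)
          (fun z => mlogCfg k η (cubeFam false L a M ρ k) (gaugeAct u⁻¹ (cutFixed L (tLo a ρ) (tHi a M ρ) U₀ k (ctr a M))) z μ) x)
        ≤ 5 * (d : ℝ) * L * B₀ * ((L : ℝ) ^ 3 * α₀ + 6 * d * (L : ℝ) ^ 2 * M * α₀) := by
  have hL1 : 1 ≤ L := le_trans (by norm_num) hL
  have hd1 : 1 ≤ d := le_trans (by norm_num) hd2
  obtain ⟨cw, hcw, hwin⟩ := prop3_windows hd2 hL hB₀.le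
  refine ⟨min cB9 cw, lt_min hcB9 hcw, ?_⟩
  intro η hη k hk a M ρ hρL hρM hM SB9 U₀ hU₀ α₀ hα hα3 hα2 Ω hA hT hsmall hc₀ hc₂ h61 hsmall₁ u hu h129 hLan h162
  have hρ : 1 ≤ ρ := hL1.trans hρL
  have hM1 : 1 ≤ M := hρ.trans hρM
  have hLr : (1 : ℝ) ≤ L := by exact_mod_cast hL1
  have hdpos : (0 : ℝ) < d := by exact_mod_cast hd1
  have hMpos : (0 : ℝ) < M := by exact_mod_cast hM1
  set α₀' : ℝ := (L : ℝ) ^ 3 * α₀ with hα₀'_def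
  set α₁' : ℝ := 6 * d * (L : ℝ) ^ 2 * M * α₀ with hα₁'_def
  set α₂ : ℝ := 5 * (d : ℝ) * L * B₀ * ((L : ℝ) ^ 3 * α₀ + 6 * d * (L : ℝ) ^ 2 * M * α₀) with hα₂_def
  have hα₀' : 0 < α₀' := by positivity
  have hα₁' : 0 < α₁' := by positivity
  have hα₂ : 0 < α₂ := by positivity
  obtain ⟨hα3', hα4', h16, hd5, hsm, hc₃, hside, h50, hC⟩ :=
    hwin α₀' α₂ hα₀' (hc₀.trans (min_le_right _ _)) hα₂.le (hc₂.trans (min_le_right _ _))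
  have hC₂' := hC.trans hC₂
  set U'' := cutFixed L (tLo a ρ) (tHi a M ρ) U₀ k (ctr a M) with hU''
  obtain ⟨hmem, h33, h34, -, -, -⟩ := thm4_hypotheses_one_cutFixed L hL hd1 k U₀ hU₀ hα hα3 hα2 a hρ hρM hM hη hA hT hsmall
  have hone : ∀ x κ, (1 : Site d → Fin d → 𝔸ˣ) x κ ∈ unitaryUnits 𝔸 := fun _ _ => (unitaryUnits 𝔸).one_mem
  have hui : ∀ x, u⁻¹ x ∈ U1 𝔸 := fun x => unitaryUnits_le_U1 ((unitaryUnits 𝔸).inv_mem (hu x))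
  have hU₁u : ∀ x κ, gaugeAct u⁻¹ U'' x κ ∈ unitaryUnits 𝔸 := gaugeAct_mem_of hmem fun x => (unitaryUnits 𝔸).inv_mem (hu x)
  set W : Site d → Fin d → 𝔸ˣ := gaugeAct u⁻¹ U'' with hW_def
  set A : Site d → Fin d → 𝔸 := mlogCfg k η (cubeFam false L a M ρ k) W with hA_def
  -- the canonical exponent: Hermitian, (1.41), `W = e^{iηA}` on the `E j`, `0` off them
  obtain ⟨hAsa, hrep, hA0⟩ := mlogCfg_spec hη hL1 k (1 : Site d → Fin d → 𝔸ˣ) hU₁u hα₂.le h16 (cubeFam false L a M ρ k)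
    (fun j hj y τ hs => ⟨(h162 j hj (y, τ) hs).1, (h162 j hj (y, τ) hs).2.2⟩)
  have h41 : ∀ j, j ≤ k → ∀ (y : Site d) (τ : Fin d), SideTouches (cubeFam false L a M ρ k j) y τ →
      W y τ = cfgExp η A y τ ∧ ‖A y τ‖ ≤ α₂ * ((L : ℝ) ^ j * η)⁻¹ := fun j hj y τ hs =>
    ⟨(hrep j hj y τ hs).2, by rw [hA_def, (hrep j hj y τ hs).1]; exact (h162 j hj (y, τ) hs).2.2⟩
  have h41' : ∀ j, j ≤ k → ∀ (y : Site d) (τ : Fin d), SideTouches (cubeFam false L a M ρ k j) y τ →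
      ‖A y τ‖ ≤ α₂ * ((L : ℝ) ^ j * η)⁻¹ := fun j hj y τ hs => (h41 j hj y τ hs).2
  -- (1.40)₂ for `W·1` by gauge invariance from (1.132), and for `e^{iηA}·1` by locality
  have hW₀ : mulCfg U'' (1 : Site d → Fin d → 𝔸ˣ) = U'' := mul_one _
  have hW₁ : mulCfg W (1 : Site d → Fin d → 𝔸ˣ) = W := mul_one _
  have hPair : InAk L k η α₀' (cubeFam false L a M ρ k) (mulCfg W (1 : Site d → Fin d → 𝔸ˣ)) := by
    rw [hW₁, hW_def, inAk_gaugeAct_iff L k η _ _ hui]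
    rw [hW₀] at h34
    exact h34
  have h40₁ : InAk L k η α₀' (cubeFam false L a M ρ k) (mulCfg (expCfg (iEta η A)) (1 : Site d → Fin d → 𝔸ˣ)) := by
    refine (inAk_congr_of_sideTouches L k η α₀' (V := mulCfg W (1 : Site d → Fin d → 𝔸ˣ)) fun j hj y τ hs => ?_).1 hPair
    show W y τ * (1 : Site d → Fin d → 𝔸ˣ) y τ = expCfg (iEta η A) y τ * (1 : Site d → Fin d → 𝔸ˣ) y τ
    rw [(h41 j hj y τ hs).1, expCfg_iEta_eq_cfgExp]
  have hAglob : ∀ y τ, ‖A y τ‖ ≤ α₂ * η⁻¹ := by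
    intro y τ
    by_cases hmem' : ∃ j, j ≤ k ∧ SideTouches (cubeFam false L a M ρ k j) y τ
    · obtain ⟨j, hj, hs⟩ := hmem'
      have hLj : (1 : ℝ) ≤ (L : ℝ) ^ j := one_le_pow₀ hLr
      calc ‖A y τ‖ ≤ α₂ * ((L : ℝ) ^ j * η)⁻¹ := h41' j hj y τ hs
        _ = α₂ * η⁻¹ * ((L : ℝ) ^ j)⁻¹ := by rw [mul_inv]; ring
        _ ≤ α₂ * η⁻¹ * 1 := by
            apply mul_le_mul_of_nonneg_left (inv_le_one_of_one_le₀ hLj) (by positivity)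
        _ = α₂ * η⁻¹ := mul_one _
    · rw [hA_def, hA0 y τ fun j hj hs => hmem' ⟨j, hj, hs⟩, norm_zero]
      positivity
  have hgrad : ∀ (y : Site d) (κ τ : Fin d), ‖covDerivFwd η (1 : Site d → Fin d → 𝔸ˣ) κ (fun z => A z τ) y‖ ≤ 2 * α₂ * η⁻¹ * η⁻¹ := by
    intro y κ τ
    unfold covDerivFwd
    rw [norm_smul, norm_inv, Real.norm_eq_abs, abs_of_pos hη]
    have h1 : ‖B7Eq78Linearization.conjR ((1 : Site d → Fin d → 𝔸ˣ) y κ) (A (y + e κ) τ) - A y τ‖ ≤ α₂ * η⁻¹ + α₂ * η⁻¹ := by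
      calc ‖B7Eq78Linearization.conjR ((1 : Site d → Fin d → 𝔸ˣ) y κ) (A (y + e κ) τ) - A y τ‖
          ≤ ‖B7Eq78Linearization.conjR ((1 : Site d → Fin d → 𝔸ˣ) y κ) (A (y + e κ) τ)‖ + ‖A y τ‖ := norm_sub_le _ _
        _ ≤ α₂ * η⁻¹ + α₂ * η⁻¹ := by
            rw [B8Ineq132.norm_conjR (unitaryUnits_le_U1 (hone y κ))]
            exact add_le_add (hAglob _ _) (hAglob _ _)
    calc η⁻¹ * ‖B7Eq78Linearization.conjR ((1 : Site d → Fin d → 𝔸ˣ) y κ) (A (y + e κ) τ) - A y τ‖ ≤ η⁻¹ * (α₂ * η⁻¹ + α₂ * η⁻¹) :=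
        mul_le_mul_of_nonneg_left h1 (by positivity)
      _ = 2 * α₂ * η⁻¹ * η⁻¹ := by ring
  have hBg : Bdd L k η (-(2 : ℝ)) (fun j (t : Fin d × Fin d × Site d) => SideTouches (cubeFam false L a M ρ k j) t.2.2 t.2.1)
      (fun t => covDerivFwd η (1 : Site d → Fin d → 𝔸ˣ) t.1 (fun z => A z t.2.1) t.2.2) := by
    have e2 : (-(2 : ℝ)) = -((2 : ℕ) : ℝ) := by norm_num
    rw [e2]
    refine B8ScaledSupNorm.bdd_of_forall (c := 2 * α₂ * ((L : ℝ) ^ k) ^ 2) fun j hj t _ => ?_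
    rw [B8ScaledSupNorm.weight_neg_natCast L η 2 j]
    have hLjk : (L : ℝ) ^ j ≤ (L : ℝ) ^ k := pow_le_pow_right₀ hLr hj
    have hLj0 : (0 : ℝ) ≤ (L : ℝ) ^ j := by positivity
    calc ((L : ℝ) ^ j * η) ^ 2 * ‖covDerivFwd η (1 : Site d → Fin d → 𝔸ˣ) t.1 (fun z => A z t.2.1) t.2.2‖
        ≤ ((L : ℝ) ^ j * η) ^ 2 * (2 * α₂ * η⁻¹ * η⁻¹) := mul_le_mul_of_nonneg_left (hgrad _ _ _) (by positivity)
      _ = 2 * α₂ * ((L : ℝ) ^ j) ^ 2 := by field_simp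
      _ ≤ 2 * α₂ * ((L : ℝ) ^ k) ^ 2 := by gcongr
  set g : ℝ := msup L k η (-(2 : ℝ)) (fun j (t : Fin d × Fin d × Site d) => SideTouches (cubeFam false L a M ρ k j) t.2.2 t.2.1)
      (fun t => covDerivFwd η (1 : Site d → Fin d → 𝔸ˣ) t.1 (fun z => A z t.2.1) t.2.2) with hg_def
  have hg0 : 0 ≤ g := B8ScaledSupNorm.msup_nonneg L k hη.le _ _ _
  have hg : ∀ j, j ≤ k → ∀ (y : Site d) (κ τ : Fin d), SideTouches (cubeFam false L a M ρ k j) y τ →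
      ((L : ℝ) ^ j * η) ^ 2 * ‖covDerivFwd η (1 : Site d → Fin d → 𝔸ˣ) κ (fun z => A z τ) y‖ ≤ g := by
    intro j hj y κ τ hs
    have h := B8ScaledSupNorm.weight_mul_norm_le_msup hBg hj (i := (κ, τ, y)) hs
    have hw : weight L η (-(2 : ℝ)) j = ((L : ℝ) ^ j * η) ^ 2 := by
      have e2 : (-(2 : ℝ)) = -((2 : ℕ) : ℝ) := by norm_num
      rw [e2, B8ScaledSupNorm.weight_neg_natCast L η 2 j]
    rw [hw] at h
    exact h
  -- the in-edge (1.59), five lines, from the socket AT THE MEMBER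
  obtain ⟨h59a, h59g, h59j, h59l, h59h⟩ := SB9 α₀' α₂ hα₀' (hc₀.trans (min_le_left _ _)) hα₂ (hc₂.trans (min_le_left _ _))
    (1 : Site d → Fin d → 𝔸ˣ) W hone hU₁u h33 hPair hLan A hAsa h41 hA0
  -- (1.42)₂ at all levels (`c137_cubeMember`) and the boxes of the constraint bonds
  have h42 := c137_cubeMember hd2 hL hk U₀ hU₀ hα hα3 hα2 a hρL hρM hM hη hA hT hsmall hα₂.le hα3' hα4' h16 hsm hc₃ hsmall₁ u hu
    h129 h162
  have hbox : ∀ j, j ≤ k → ∀ c ∈ cubeLamB L a M ρ k k j, ∀ x, InBox (loK L j c.1) (bondHiK L j c.1 c.2) x → x ∈ cubeFam false L a M ρ k j :=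
    fun j hj c hc x hx => hbox_cubeLamB L a M ρ k k le_rfl j hj c hc x hx
  -- PROPOSITION 3 at `k` levels (n05-b): the four members and the Hölder member
  obtain ⟨-, hg', hj, hl⟩ := B8Prop3KLevel.prop3_norms_kLevel hd2 hη hL hone hAsa hα₀' hα₁'.le hα₂.le hg0 hα3' hα4' h16 hd5 hsm hc₃
    hB₀.le hside h50 hC₂' h61 hbox h33 h40₁ h41' hg h42 h59a h59g h59j h59l
  have hh := B8Prop3KLevel.prop3_fifth_kLevel hd2 hη hL hone hAsa hα₀' hα₁'.le hα₂.le hg0 hα3' hα4' h16 hd5 hsm hc₃ hB₀.le hB₀β hside h50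
    hC₂' h61 hbox h33 h40₁ h41' hg h42 h59g h59h
  exact ⟨hg', hh, hj, hl⟩

/-! ## §3 Print's hypotheses «7dL²Mα₀ ≤ c₁», «L ≤ dM» and print's constant `7dL²B₁Mα₀` -/

/-- **EVERY WINDOW FROM ONE THRESHOLD** (bookkeeping for «α₀, α₁, α₂ bounded by a constant depending on d and L only», p. 87, and «let
7dL²Mα₀ ≤ c₁», p. 99): for `d, L ≥ 2`, `B₀ > 0`, `C₂ ≥ 0` and a Proposition-3 threshold `c > 0` there is `c₁(d, L, B₀, C₂, c) > 0` such that
`7dL²Mα₀ ≤ c₁` and `L ≤ dM` give, with `(α₀′, α₁′) = (L³α₀, 6dL²Mα₀)`, `t = α₀′ + α₁′`, `α₂ = 5dLB₀·t`: the (1.130)-regime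
(`B8Prop6CubeMember.regime_of_printed_smallness`), `α₀′, α₁′, α₂ ≤ c`, (1.61) (`ineq161_of_small`), the [3]-Prop.-4 ∕ Prop.-3 windows at
`(α₀′, α₂)` (`B8LeafModelZd3.prop3_windows`), `dLα₁′ ≤ 1∕8` and `dMα₀ ≤ 1∕2`. [cite: Balaban1985RegularSpaces, Prop. 3 p.87, (1.61) p.86, Prop. 6 p.99, (1.130) p.98] -/
theorem windows136_of_small (hd2 : 2 ≤ d) {L : ℕ} (hL : 2 ≤ L) {B₀ C₂ c : ℝ} (hB₀ : 0 < B₀) (hC₂ : 0 ≤ C₂) (hc : 0 < c) :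
    ∃ c₁ : ℝ, 0 < c₁ ∧ ∀ (M ρ : ℕ), 1 ≤ M → ρ ≤ M → 11 * (d : ℝ) < M → (L : ℝ) ≤ d * M → ∀ (α₀ : ℝ), 0 < α₀ →
      7 * d * (L : ℝ) ^ 2 * M * α₀ ≤ c₁ →
      (C0 d * (α₀ * (L : ℝ) ^ 2) ≤ 1 / 3 ∧ 2 * (α₀ * (L : ℝ) ^ 2) ≤ c2' d L ∧
        11 * (d : ℝ) ^ 2 * (L : ℝ) ^ 2 * α₀ + ((M : ℝ) + 4 * ρ) * d * (L : ℝ) ^ 2 * α₀ ≤ 1 / 6) ∧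
      ((L : ℝ) ^ 3 * α₀ ≤ c ∧ 6 * d * (L : ℝ) ^ 2 * M * α₀ ≤ c ∧
        5 * (d : ℝ) * L * B₀ * ((L : ℝ) ^ 3 * α₀ + 6 * d * (L : ℝ) ^ 2 * M * α₀) ≤ c) ∧
      2 * (5 * (d : ℝ) * L * B₀ * ((L : ℝ) ^ 3 * α₀ + 6 * d * (L : ℝ) ^ 2 * M * α₀)) ^ 2
        + 20 * d * ((L : ℝ) ^ 3 * α₀) * (5 * (d : ℝ) * L * B₀ * ((L : ℝ) ^ 3 * α₀ + 6 * d * (L : ℝ) ^ 2 * M * α₀))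
        + 2 * C₂ * (5 * (d : ℝ) * L * B₀ * ((L : ℝ) ^ 3 * α₀ + 6 * d * (L : ℝ) ^ 2 * M * α₀)) ^ 2
        ≤ (L : ℝ) ^ 3 * α₀ + 6 * d * (L : ℝ) ^ 2 * M * α₀ ∧
      (C0 d * ((L : ℝ) ^ 3 * α₀) ≤ 1 / 3 ∧ 4 * ((L : ℝ) ^ 3 * α₀) ≤ c2' d L ∧
        16 * (5 * (d : ℝ) * L * B₀ * ((L : ℝ) ^ 3 * α₀ + 6 * d * (L : ℝ) ^ 2 * M * α₀)) ≤ 1 ∧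
        Real.exp (4 * (800 * ((d : ℝ) + 1) ^ 2 * ((d : ℝ) + 4)) * ((L : ℝ) ^ 3 * α₀))
          * (1 + 8 * (131072 * ((d : ℝ) + 1) ^ 2) * (5 * (d : ℝ) * L * B₀ * ((L : ℝ) ^ 3 * α₀ + 6 * d * (L : ℝ) ^ 2 * M * α₀))) ≤ 2 ∧
        2 * (5 * (d : ℝ) * L * B₀ * ((L : ℝ) ^ 3 * α₀ + 6 * d * (L : ℝ) ^ 2 * M * α₀)) ≤ c3 d L ∧
        (d : ℝ) * L * (6 * d * (L : ℝ) ^ 2 * M * α₀) ≤ 1 / 8) ∧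
      (d : ℝ) * M * α₀ ≤ 1 / 2 := by
  have hL1 : 1 ≤ L := le_trans (by norm_num) hL
  have hd1 : 1 ≤ d := le_trans (by norm_num) hd2
  have hLpos : (0 : ℝ) < L := by exact_mod_cast hL1
  have hL2 : (2 : ℝ) ≤ L := by exact_mod_cast hL
  have hdpos : (0 : ℝ) < d := by exact_mod_cast hd1
  have hC0 := C0_pos d
  have hc2 := c2'_pos d L hL1
  obtain ⟨cw, hcw, hwin⟩ := B8LeafModelZd3.prop3_windows hd2 hL hB₀.le
  set B : ℝ := 5 * (d : ℝ) * L * B₀ with hB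
  have hBpos : 0 < B := by positivity
  set K : ℝ := (2 + 2 * C₂) * B ^ 2 + 20 * d * B with hK
  have hKpos : 0 < K := by positivity
  refine ⟨min c (min (c / B) (min cw (min (cw / B) (min (1 / K) (min (1 / (8 * d * L)) (min 14
    (min (7 / (3 * C0 d)) (min (7 * c2' d L / 2) (7 / 36))))))))), ?_, ?_⟩
  · exact lt_min hc (lt_min (by positivity) (lt_min hcw (lt_min (by positivity) (lt_min (by positivity) (lt_min (by positivity)
      (lt_min (by norm_num) (lt_min (by positivity) (lt_min (by positivity) (by norm_num)))))))))
  intro M ρ hM1 hρM hM hLdM α₀ hα hs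
  simp only [le_min_iff] at hs
  obtain ⟨hs_c, hs_cB, hs_w, hs_wB, hs_K, hs_8, hs_14, hs_r1, hs_r2, hs_r3⟩ := hs
  have hMpos : (0 : ℝ) < M := by exact_mod_cast lt_of_lt_of_le (by norm_num) hM1
  set s : ℝ := 7 * d * (L : ℝ) ^ 2 * M * α₀ with hs_def
  set t : ℝ := (L : ℝ) ^ 3 * α₀ + 6 * d * (L : ℝ) ^ 2 * M * α₀ with ht_def
  have hα₀' : 0 < (L : ℝ) ^ 3 * α₀ := by positivity
  have hα₁' : 0 < 6 * d * (L : ℝ) ^ 2 * M * α₀ := by positivity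
  have hts : t ≤ s := (B8.prop6_smallness_iff hLpos hα).2 hLdM
  have h0t : (L : ℝ) ^ 3 * α₀ ≤ t := by rw [ht_def]; linarith
  have h1t : 6 * d * (L : ℝ) ^ 2 * M * α₀ ≤ t := by rw [ht_def]; linarith
  have htpos : 0 < t := by positivity
  have hBt : B * t ≤ B * s := mul_le_mul_of_nonneg_left hts hBpos.le
  have hBs_c : B * s ≤ c := by
    have := mul_le_mul_of_nonneg_left hs_cB hBpos.le
    rwa [mul_div_cancel₀ _ hBpos.ne'] at this
  have hBs_w : B * s ≤ cw := by
    have := mul_le_mul_of_nonneg_left hs_wB hBpos.le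
    rwa [mul_div_cancel₀ _ hBpos.ne'] at this
  -- the (1.130)-regime
  have hreg := regime_of_printed_smallness (L := L) hd1 hM1 hρM hM hα le_rfl hs_r1 hs_r2 hs_r3
  -- (1.61)
  have hKt : K * t ≤ 1 := by
    calc K * t ≤ K * s := mul_le_mul_of_nonneg_left hts hKpos.le
      _ ≤ K * (1 / K) := mul_le_mul_of_nonneg_left hs_K hKpos.le
      _ = 1 := by field_simp
  have h61 := ineq161_of_small (C₂ := C₂) hdpos.le h0t htpos.le hBpos.le hKt
  -- the Prop.-3 / [3]-Prop.-4 windows at `(α₀′, α₂ = B·t)`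
  obtain ⟨hα3', hα4', h16, -, hsm, hc₃, -, -, -⟩ :=
    hwin ((L : ℝ) ^ 3 * α₀) (B * t) hα₀' (h0t.trans (hts.trans hs_w)) (by positivity) (hBt.trans hBs_w)
  -- `dLα₁′ ≤ 1/8` and `dMα₀ ≤ 1/2`
  have h8 : (d : ℝ) * L * (6 * d * (L : ℝ) ^ 2 * M * α₀) ≤ 1 / 8 := by
    have hdL : (0 : ℝ) < d * L := by positivity
    calc (d : ℝ) * L * (6 * d * (L : ℝ) ^ 2 * M * α₀) ≤ (d * L) * s := mul_le_mul_of_nonneg_left (h1t.trans hts) hdL.le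
      _ ≤ (d * L) * (1 / (8 * d * L)) := mul_le_mul_of_nonneg_left hs_8 hdL.le
      _ = 1 / 8 := by field_simp
  have h12 : (d : ℝ) * M * α₀ ≤ 1 / 2 := by
    have hL4 : (2 : ℝ) ^ 2 ≤ (L : ℝ) ^ 2 := pow_le_pow_left₀ (by norm_num) hL2 2
    have hdM0 : 0 ≤ 7 * ((d : ℝ) * M * α₀) := by positivity
    have h28 : 7 * ((d : ℝ) * M * α₀) * (2 : ℝ) ^ 2 ≤ 7 * ((d : ℝ) * M * α₀) * (L : ℝ) ^ 2 :=
      mul_le_mul_of_nonneg_left hL4 hdM0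
    have e : 7 * ((d : ℝ) * M * α₀) * (L : ℝ) ^ 2 = s := by rw [hs_def]; ring
    rw [e] at h28
    linarith
  exact ⟨hreg, ⟨h0t.trans (hts.trans hs_c), h1t.trans (hts.trans hs_c), hBt.trans hBs_c⟩, h61,
    ⟨hα3', hα4', h16, hsm, hc₃, h8⟩, h12⟩

/-- **(1.136)₂–₄, THE HÖLDER MEMBER AND THE ALL-LEVELS (1.37) AT THE CONCRETE CUBE MEMBER WITH PRINT'S HYPOTHESES AND CONSTANT** — Proposition 6's
«(Lʲη)²|∇^ηA|, (Lʲη)³|∂^{η*}∂^ηA|, (Lʲη)³|Δ^ηA| < 7dL²B₁Mα₀ on □_j», `B₁ = 5dLB₀` (p. 99), in the k-level norm currency of the lineage: ONE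
threshold `c₁(d, L, B₀, C₂, c_{P3}) > 0` such that for every datum of Sect. F with «`7dL²Mα₀ ≤ c₁`» and the implicit «`L ≤ dM`»
(`B8Prop6OfThm4.smallness_134`), and every unitary `u` with (1.29) at level `k`, (1.38) of record and the (1.62)-shape with Theorem 4's
constant `5dLB₀(L³α₀ + 6dL²Mα₀)` (n05-c's `prop6_exists_cubeMember_at`), for `A := mlogCfg k η {□_j} U₁`, `U₁ = U₀″^{u⁻¹}`:
`‖Q_j(1, iηA)(c)‖ < 2dL·6dL²Mα₀` on `cubeLamB … k j` (`j ≤ k`), `|∇^ηA|₍₋₂₎ ≤ 7dL²(5dLB₀)Mα₀`, Hölder `≤ 7dL²(5dLB₀β)Mα₀`,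
`|∂^{η*}∂^ηA|₍₋₃₎, |Δ^ηA|₍₋₃₎ ≤ 7dL²(5dLB₀)Mα₀` — MODULO the Prop.-3-frame b9 socket AT THE CUBE MEMBER.
[cite: Balaban1985RegularSpaces, Prop. 6 (1.136) p.99, Prop. 3 p.87, (1.37) p.82, (1.134) p.99] -/
theorem norms136_cubeMember_printed (hd2 : 2 ≤ d) {L : ℕ} (hL : 2 ≤ L) {B₀ B₀β C₂ cB9 : ℝ} (hB₀ : 0 < B₀)
    (hB₀β : 0 ≤ B₀β) (hC₂ : 2097152 * ((d : ℝ) + 1) ^ 2 ≤ C₂) (hcB9 : 0 < cB9) (β : ℝ) (len : Site d → ℝ) :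
    ∃ c₁ : ℝ, 0 < c₁ ∧ ∀ (η : ℝ), 0 < η → ∀ (k : ℕ), 1 ≤ k → ∀ (a : Site d) (M ρ : ℕ), L ≤ ρ → ρ ≤ M → 11 * (d : ℝ) < M →
      (L : ℝ) ≤ d * M →
      SockB9P3 (𝔸 := 𝔸) L B₀ B₀β cB9 β len η k (cubeFam false L a M ρ k) (cubeLamS L a M ρ k) (cubeLamB L a M ρ k) →
      ∀ (U₀ : Site d → Fin d → 𝔸ˣ), (∀ x κ, U₀ x κ ∈ unitaryUnits 𝔸) → ∀ (α₀ : ℝ), 0 < α₀ →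
      ∀ (Ω : ℕ → Set (Site d)), InAk L k η α₀ Ω U₀ → tcube L a M ρ k ⊆ Ω (k - 1) →
      7 * d * (L : ℝ) ^ 2 * M * α₀ ≤ c₁ →
      ∀ (u : Site d → 𝔸ˣ), (∀ x, u x ∈ unitaryUnits 𝔸) →
      Restr129 L k (cubeLamS L a M ρ k k) (1 : Site d → Fin d → 𝔸ˣ) u →
      IsLandau138W L k η (cubeFam false L a M ρ k 0) (cubeLamS L a M ρ k k) (1 : Site d → Fin d → 𝔸ˣ)
        (gaugeAct u⁻¹ (cutFixed L (tLo a ρ) (tHi a M ρ) U₀ k (ctr a M))) →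
      (∀ j, j ≤ k → ∀ b ∈ {b : Site d × Fin d | SideTouches (cubeFam false L a M ρ k j) b.1 b.2},
        gaugeAct u⁻¹ (cutFixed L (tLo a ρ) (tHi a M ρ) U₀ k (ctr a M)) b.1 b.2 =
            cfgExp η (logCfg η (gaugeAct u⁻¹ (cutFixed L (tLo a ρ) (tHi a M ρ) U₀ k (ctr a M)))) b.1 b.2 ∧
          IsSelfAdjoint (logCfg η (gaugeAct u⁻¹ (cutFixed L (tLo a ρ) (tHi a M ρ) U₀ k (ctr a M))) b.1 b.2) ∧
          ‖logCfg η (gaugeAct u⁻¹ (cutFixed L (tLo a ρ) (tHi a M ρ) U₀ k (ctr a M))) b.1 b.2‖ ≤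
            (5 * (d : ℝ) * L * B₀ * ((L : ℝ) ^ 3 * α₀ + 6 * d * (L : ℝ) ^ 2 * M * α₀)) * ((L : ℝ) ^ j * η)⁻¹) →
      (∀ j, j ≤ k → ∀ c ∈ cubeLamB L a M ρ k k j,
        ‖logCovIter L (1 : Site d → Fin d → 𝔸ˣ)
            (iEta η (mlogCfg k η (cubeFam false L a M ρ k) (gaugeAct u⁻¹ (cutFixed L (tLo a ρ) (tHi a M ρ) U₀ k (ctr a M)))))
            j c.1 c.2‖ < 2 * d * L * (6 * d * (L : ℝ) ^ 2 * M * α₀)) ∧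
      msup L k η (-(2 : ℝ)) (fun j (t : Fin d × Fin d × Site d) => SideTouches (cubeFam false L a M ρ k j) t.2.2 t.2.1)
          (fun t => covDerivFwd η (1 : Site d → Fin d → 𝔸ˣ) t.1 (fun z => mlogCfg k η (cubeFam false L a M ρ k)
            (gaugeAct u⁻¹ (cutFixed L (tLo a ρ) (tHi a M ρ) U₀ k (ctr a M))) z t.2.1) t.2.2)
        ≤ 7 * d * (L : ℝ) ^ 2 * (5 * (d : ℝ) * L * B₀) * M * α₀ ∧
      msup L k η (-(2 + β)) (fun j (q : Fin d × Fin d × (Site d × Site d)) => q.2.2 ∈ AdmPair η len ∧ q.2.2.1 ∈ cubeFam false L a M ρ k j)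
          (fun q => hquot η β len (1 : Site d → Fin d → 𝔸ˣ) (covDerivFwd η (1 : Site d → Fin d → 𝔸ˣ) q.1
            (fun z => mlogCfg k η (cubeFam false L a M ρ k) (gaugeAct u⁻¹ (cutFixed L (tLo a ρ) (tHi a M ρ) U₀ k (ctr a M))) z q.2.1))
            q.2.2)
        ≤ 7 * d * (L : ℝ) ^ 2 * (5 * (d : ℝ) * L * B₀β) * M * α₀ ∧
      bondNorm L k η (-(3 : ℝ)) (cubeFam false L a M ρ k) (fun x μ => pdiv η (1 : Site d → Fin d → 𝔸ˣ)
          (plaqCovDeriv η (1 : Site d → Fin d → 𝔸ˣ) (mlogCfg k η (cubeFam false L a M ρ k)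
            (gaugeAct u⁻¹ (cutFixed L (tLo a ρ) (tHi a M ρ) U₀ k (ctr a M))))) μ x)
        ≤ 7 * d * (L : ℝ) ^ 2 * (5 * (d : ℝ) * L * B₀) * M * α₀ ∧
      bondNorm L k η (-(3 : ℝ)) (cubeFam false L a M ρ k) (fun x μ => covLap η (1 : Site d → Fin d → 𝔸ˣ)
          (fun z => mlogCfg k η (cubeFam false L a M ρ k) (gaugeAct u⁻¹ (cutFixed L (tLo a ρ) (tHi a M ρ) U₀ k (ctr a M))) z μ) x)
        ≤ 7 * d * (L : ℝ) ^ 2 * (5 * (d : ℝ) * L * B₀) * M * α₀ := by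
  have hL1 : 1 ≤ L := le_trans (by norm_num) hL
  have hd1 : 1 ≤ d := le_trans (by norm_num) hd2
  have hLpos : (0 : ℝ) < L := by exact_mod_cast hL1
  have hdpos : (0 : ℝ) < d := by exact_mod_cast hd1
  have hC₂0 : 0 ≤ C₂ := le_trans (by positivity) hC₂
  obtain ⟨c, hc, H⟩ := norms136_cubeMember_at (𝔸 := 𝔸) hd2 hL hB₀ hB₀β hC₂ hcB9 β len
  obtain ⟨c₁, hc₁, W⟩ := windows136_of_small hd2 hL hB₀ hC₂0 hc
  refine ⟨c₁, hc₁, ?_⟩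
  intro η hη k hk a M ρ hρL hρM hM hLdM SB9 U₀ hU₀ α₀ hα Ω hA hT hs u hu h129 hLan h162
  have hρ : 1 ≤ ρ := hL1.trans hρL
  have hM1 : 1 ≤ M := hρ.trans hρM
  obtain ⟨⟨hα3, hα2, hsmall⟩, ⟨hc₀, -, hc₂⟩, h61, ⟨hα3', hα4', h16, hsm, hc₃, h8⟩, -⟩ := W M ρ hM1 hρM hM hLdM α₀ hα hs
  have h137 := c137_cubeMember hd2 hL hk U₀ hU₀ hα hα3 hα2 a hρL hρM hM hη hA hT hsmall (by positivity) hα3' hα4' h16 hsm hc₃ h8 u hu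
    h129 h162
  obtain ⟨hg, hh, hj, hl⟩ := H η hη k hk a M ρ hρL hρM hM SB9 U₀ hU₀ α₀ hα hα3 hα2 Ω hA hT hsmall hc₀ hc₂ h61 h8 u hu h129 hLan h162
  have hB : 0 ≤ 5 * (d : ℝ) * L * B₀ := by positivity
  have hBβ : 0 ≤ 5 * (d : ℝ) * L * B₀β := by positivity
  have e136 := const_136 hLpos hα hB hLdM
  have e136β := const_136 hLpos hα hBβ hLdM
  exact ⟨h137, hg.trans e136, hh.trans e136β, hj.trans e136, hl.trans e136⟩

end Literature.MathematicalPhysics.QuantumFieldTheory.Balaban1983to89.B8Prop6CubeMemberNormsAt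

end
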